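import Mathlib.NumberTheory.ArithmeticFunction.Liouville
import Mathlib.Logic.Equiv.Fin.Basic
import Mathlib.Data.Fintype.BigOperators
import Mathlib.Analysis.SpecificLimits.Basic
import Literature.Probability.Entropy.FiniteShannon
import HarnessLib

/-!
# Empirical block entropy of the Liouville sign word

Topic `Literature/NumberTheory/Multiplicative`. Everything in this file is PROVED (definitions with
bodies and theorems; no named facts).

For `X M : ℕ` draw `n` uniformly from `[0, X)` and read the **sign word** of the Liouville function
`(λ(n+1), …, λ(n+M)) ∈ {±1}^M`, encoded as the Boolean word `liouvilleWord M n : Fin M → Bool`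
(`true` at position `j` iff `λ(n+1+j) = 1`). Its empirical law is
`liouvilleBlockFreq X M w = #{n < X : word = w} / X`, and

* `liouvilleBlockEntropy X M = ∑_w φ(liouvilleBlockFreq X M w)`, `φ = Real.negMulLog`
  (`φ(x) = -x log x`), is the Shannon entropy (natural logarithm) of that law;
* `liouvilleBlockEntropyRate X M = liouvilleBlockEntropy X M / M` is the per-symbol entropy.

This is the entropy `𝐇(𝐗_H)` of the window random variable `𝐗_H` of Tao's entropy decrement
argument (Tao 2016, §2 before Remark 2.7 and §3), taken here at NATURAL scale (uniform `n < X`)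
as in Tao–Teräväinen 2019, §5 (the random variable `𝐗^{(d)} ∈ {−1,+1}^{(2ah+1)2^m}` of sign
patterns and its entropy bound `𝐇(𝐗^{(d)}) ≤ ε⁵ 2^m / m`), rather than with the logarithmic weights
of Tao 2016. The definitions are written so that `liouvilleBlockFreq X M w` and
`liouvilleBlockEntropy X M` are, token for token, the `let freq` / `let ent` inlined in the route
item `UniformEntropyRate` of `Summits/Parity/GeneralizedHardyLittlewood/Theses/EntropyRate.lean`
(checked in a scratch file importing that route, rev 1: `UniformEntropyRate ↔ ∀ ε, 0 < ε → ∀ k,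
2 ≤ k → ∀ H₁, ∃ H, H₁ ≤ H ∧ 2 ≤ H ∧ ∃ X₀, ∀ X, X₀ ≤ X → liouvilleBlockEntropyRate X H -
liouvilleBlockEntropyRate X (k * H) ≤ ε / Real.log H` holds by `Iff.rfl`; not stated here because
Literature does not import Summits), and `liouvilleBlockEntropy_eq_ent` identifies the entropy with
`Literature.Probability.Entropy.FiniteShannon.ent` on the uniformly weighted set `Finset.range X`,
which makes the whole Shannon toolkit of that file (chain rule, subadditivity, `H ≤ log N`,
continuity in the law) available.

## Content
* `liouvilleWord_eq_iff`; `liouvilleWord_add` (the word of length `M₁ + M₂` is `Fin.append` of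
  the word of length `M₁` and the word of length `M₂` read `M₁` steps later);
* `liouvilleBlockFreq_eq_prob`, `liouvilleBlockEntropy_eq_ent` — the bridge to `FiniteShannon`;
* `liouvilleBlockFreq_nonneg`, `liouvilleBlockFreq_le_one`, `sum_liouvilleBlockFreq_eq_one`,
  `liouvilleBlockEntropy_nonneg`, `liouvilleBlockEntropy_le` (`≤ M log 2`, Tao 2016 (3.7)/(3.8)),
  `liouvilleBlockEntropyRate_nonneg`, `liouvilleBlockEntropyRate_le_log_two`;
* approximate translation invariance `abs_prob_shift_sub_liouvilleBlockFreq_le` (shifting the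
  window by `a` moves each empirical frequency by at most `a / X`) and the resulting
  **approximate subadditivity** (Tao 2016, (3.11), at natural scale with an explicit error)
  `liouvilleBlockEntropy_add_le`: `ent X (M₁+M₂) ≤ ent X M₁ + ent X M₂ + 2^{M₂} (φ(M₁/X) + M₁/X)`
  for `M₁ ≤ X`; the error tends to `0` (`tendsto_liouvilleBlockEntropySubaddError`), packaged as
  `liouvilleBlockEntropy_add_le_add_add_littleO` (an error valid for every `X` and `→ 0`).

## References
* T. Tao, *The logarithmically averaged Chowla and Elliott conjectures for two-point
  correlations*, Forum Math. Pi 4 (2016) e8; arXiv:1509.05422: §2 (definition of `𝐗_H`, display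
  before Remark 2.7), §3 (definition of `𝐇`, (3.4), (3.7), (3.8), (3.11)).
* T. Tao, J. Teräväinen, *The structure of correlations of multiplicative functions at almost all
  scales…*, Algebra Number Theory 13 (2019); arXiv:1809.02518: Thm 1.17 and §5 (natural-scale
  sign-pattern random variable `𝐗^{(d)}` and its entropy).

## Design choices / junk values
* Natural logarithms (nats), as in both sources.
* `X = 0`: every frequency is `0 / 0 = 0`, so entropy and rate are `0`. `M = 0`: the only word is
  the empty one, the entropy is `0` (`liouvilleBlockEntropy_zero_right`), the rate is `0 / 0 = 0`.
* The word starts at `n + 1` (not `n`), following the route item and Tao's `j = 1, …, H`; in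
  particular `λ(0) = 0` (Mathlib's junk value) is never read.
* Deliberately NOT here: the entropy decrement / pigeonhole itself (see
  `Literature.Probability.Entropy.EntropyOfWindows` and the Tao 2016 files under
  `Literature/NumberTheory/LFunctions`), conditional versions, and the logarithmic weights.
-/

open Finset Real Filter
open scoped Topology

noncomputable section

namespace Literature.NumberTheory.Multiplicative
open Literature.Probability.Entropy

/-! ### The sign word and its empirical law -/

/-- The **Liouville sign word** of length `M` read after `n`: position `j < M` carries `true` iff
`λ(n + 1 + j) = 1` (so the word lists the signs of `λ(n+1), …, λ(n+M)`).
[cite: TaoFMP2016, §2 (the random variable 𝐗_H, display before Remark 2.7)] -/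
def liouvilleWord (M n : ℕ) : Fin M → Bool :=
  fun j => decide (ArithmeticFunction.liouville (n + 1 + (j : ℕ)) = 1)

/-- The **empirical frequency** of the sign word `w` among `(λ(n+1), …, λ(n+M))`, `n < X`:
`#{n < X : ∀ j, (λ(n+1+j) = 1 ↔ w j)} / X` (`= 0` for `X = 0`). Written token for token as the
`let freq` of the route item `UniformEntropyRate` (route EntropyRate, Parity).
[cite: TaoTeravainen2019AlmostAllScales, §5 (law of the sign-pattern variable 𝐗^{(d)})] -/
def liouvilleBlockFreq (X M : ℕ) (w : Fin M → Bool) : ℝ :=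
  ((((Finset.range X).filter (fun n : ℕ => ∀ j : Fin M,
    (ArithmeticFunction.liouville (n + 1 + (j : ℕ)) = 1 ↔ w j = true))).card : ℕ) : ℝ) / X

/-- The **empirical block entropy** (nats) of the Liouville sign word of length `M` at scale `X`:
the Shannon entropy `∑_w φ(freq_X(w))`, `φ(x) = -x log x`, of the empirical law of
`(λ(n+1), …, λ(n+M))` for `n` uniform in `[0, X)` — Tao's `𝐇(𝐗_H)` at natural scale.
[cite: TaoFMP2016, §3 (definition of 𝐇(𝐗) and (3.8) for 𝐗_H)] -/
def liouvilleBlockEntropy (X M : ℕ) : ℝ :=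
  ∑ w : Fin M → Bool, negMulLog (liouvilleBlockFreq X M w)

/-- The **empirical block entropy rate** `𝐇(𝐗_M) / M` (nats per symbol; `= 0` for `M = 0`).
[cite: TaoFMP2016, §3 (3.12)] -/
def liouvilleBlockEntropyRate (X M : ℕ) : ℝ :=
  liouvilleBlockEntropy X M / M

/-- Unfolding `liouvilleWord`. [folklore] -/
theorem liouvilleWord_apply (M n : ℕ) (j : Fin M) :
    liouvilleWord M n j = decide (ArithmeticFunction.liouville (n + 1 + (j : ℕ)) = 1) := rfl

/-- The pattern condition of `liouvilleBlockFreq` says exactly that the sign word is `w`.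
[folklore] -/
theorem liouvilleWord_eq_iff (M n : ℕ) (w : Fin M → Bool) :
    liouvilleWord M n = w ↔
      ∀ j : Fin M, (ArithmeticFunction.liouville (n + 1 + (j : ℕ)) = 1 ↔ w j = true) := by
  rw [funext_iff]
  refine forall_congr' fun j => ?_
  rw [liouvilleWord_apply]
  rcases Bool.eq_false_or_eq_true (w j) with h | h <;> simp [h]

/-- `liouvilleBlockFreq` as a normalised count of `{n < X : liouvilleWord M n = w}`. [folklore] -/
theorem liouvilleBlockFreq_eq_card_filter (X M : ℕ) (w : Fin M → Bool) :
    liouvilleBlockFreq X M w =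
      ((((Finset.range X).filter fun n => liouvilleWord M n = w).card : ℕ) : ℝ) / X := by
  unfold liouvilleBlockFreq
  rw [Finset.filter_congr fun n _ => (liouvilleWord_eq_iff M n w).symm]

/-- Unfolding `liouvilleBlockEntropy`. [folklore] -/
theorem liouvilleBlockEntropy_def (X M : ℕ) :
    liouvilleBlockEntropy X M = ∑ w : Fin M → Bool, negMulLog (liouvilleBlockFreq X M w) := rfl

/-- Unfolding `liouvilleBlockEntropyRate`. [folklore] -/
theorem liouvilleBlockEntropyRate_def (X M : ℕ) :
    liouvilleBlockEntropyRate X M = liouvilleBlockEntropy X M / M := rfl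

/-! ### Bridge to `FiniteShannon` (uniform weights on `Finset.range X`) -/

/-- The empirical frequency is the `FiniteShannon` probability `P(liouvilleWord M = w)` on
`Finset.range X` with unit weights. [folklore] -/
theorem liouvilleBlockFreq_eq_prob (X M : ℕ) (w : Fin M → Bool) :
    liouvilleBlockFreq X M w =
      FiniteShannon.prob (Finset.range X) (fun _ => (1 : ℝ)) (liouvilleWord M) w := by
  rw [FiniteShannon.prob_def, FiniteShannon.mass_def, FiniteShannon.mass_def,
    liouvilleBlockFreq_eq_card_filter]
  simp

/-- **The block entropy is the Shannon entropy** (in the sense of `FiniteShannon.ent`) of the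
sign word on the uniformly weighted set `Finset.range X`. [folklore] -/
theorem liouvilleBlockEntropy_eq_ent (X M : ℕ) :
    liouvilleBlockEntropy X M =
      FiniteShannon.ent (Finset.range X) (fun _ => (1 : ℝ)) (liouvilleWord M) := by
  rw [FiniteShannon.ent_eq_sum_of_subset (t := Finset.univ) (Finset.subset_univ _),
    liouvilleBlockEntropy_def]
  simp_rw [liouvilleBlockFreq_eq_prob]

/-! ### Elementary bounds -/

/-- `freq ≥ 0`. [folklore] -/
theorem liouvilleBlockFreq_nonneg (X M : ℕ) (w : Fin M → Bool) :
    0 ≤ liouvilleBlockFreq X M w :=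
  div_nonneg (Nat.cast_nonneg _) (Nat.cast_nonneg _)

/-- `freq ≤ 1`. [folklore] -/
theorem liouvilleBlockFreq_le_one (X M : ℕ) (w : Fin M → Bool) :
    liouvilleBlockFreq X M w ≤ 1 := by
  unfold liouvilleBlockFreq
  refine div_le_one_of_le₀ ?_ (Nat.cast_nonneg _)
  exact_mod_cast (Finset.card_filter_le _ _).trans (Finset.card_range X).le

/-- The empirical law is a probability vector (for `X ≠ 0`). [folklore] -/
theorem sum_liouvilleBlockFreq_eq_one {X : ℕ} (hX : X ≠ 0) (M : ℕ) :
    ∑ w : Fin M → Bool, liouvilleBlockFreq X M w = 1 := by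
  simp_rw [liouvilleBlockFreq_eq_prob]
  refine FiniteShannon.sum_prob_eq_one ?_ (Finset.subset_univ _)
  refine FiniteShannon.mass_pos (fun _ _ => zero_lt_one) ?_
  exact Finset.nonempty_range_iff.2 hX

/-- `𝐇 ≥ 0`. [cite: TaoFMP2016, §3 (3.8)] -/
theorem liouvilleBlockEntropy_nonneg (X M : ℕ) : 0 ≤ liouvilleBlockEntropy X M :=
  Finset.sum_nonneg fun w _ =>
    negMulLog_nonneg (liouvilleBlockFreq_nonneg X M w) (liouvilleBlockFreq_le_one X M w)

/-- **`𝐇(𝐗_M) ≤ M log 2`**: a word of length `M` over `{±1}` takes at most `2^M` values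
(Tao 2016, (3.7): `𝐇(𝐗) ≤ log N`; this is his (3.8) `𝐇(𝐗_H) ≪ H` with the sharp constant).
[cite: TaoFMP2016, §3 (3.7)–(3.8)] -/
theorem liouvilleBlockEntropy_le (X M : ℕ) : liouvilleBlockEntropy X M ≤ M * Real.log 2 := by
  rw [liouvilleBlockEntropy_eq_ent]
  have h := FiniteShannon.ent_le_log_card (s := Finset.range X) (w := fun _ => (1 : ℝ))
    (X := liouvilleWord M) (fun _ _ => zero_le_one) (t := Finset.univ) (Finset.subset_univ _)
  have hcard : ((Finset.univ : Finset (Fin M → Bool)).card : ℝ) = 2 ^ M := by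
    rw [Finset.card_univ, Fintype.card_fun, Fintype.card_bool, Fintype.card_fin]
    push_cast
    rfl
  rwa [hcard, Real.log_pow] at h

/-- For `M = 0` the block entropy vanishes (one word). [folklore] -/
@[simp] theorem liouvilleBlockEntropy_zero_right (X : ℕ) : liouvilleBlockEntropy X 0 = 0 :=
  le_antisymm (by simpa using liouvilleBlockEntropy_le X 0) (liouvilleBlockEntropy_nonneg X 0)

/-- For `X = 0` the block entropy vanishes (all frequencies are `0`). [folklore] -/
@[simp] theorem liouvilleBlockEntropy_zero_left (M : ℕ) : liouvilleBlockEntropy 0 M = 0 := by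
  simp [liouvilleBlockEntropy_def, liouvilleBlockFreq]

/-- `0 ≤ 𝐇(𝐗_M)/M`. [folklore] -/
theorem liouvilleBlockEntropyRate_nonneg (X M : ℕ) : 0 ≤ liouvilleBlockEntropyRate X M :=
  div_nonneg (liouvilleBlockEntropy_nonneg X M) (Nat.cast_nonneg M)

/-- **`𝐇(𝐗_M)/M ≤ log 2`** (at most one bit per symbol). [cite: TaoFMP2016, §3 (3.7)–(3.8)] -/
theorem liouvilleBlockEntropyRate_le_log_two (X M : ℕ) :
    liouvilleBlockEntropyRate X M ≤ Real.log 2 := by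
  unfold liouvilleBlockEntropyRate
  rcases Nat.eq_zero_or_pos M with rfl | hM
  · simpa using Real.log_nonneg one_le_two
  · rw [div_le_iff₀ (by exact_mod_cast hM), mul_comm]
    exact liouvilleBlockEntropy_le X M

/-! ### Concatenation of words and approximate subadditivity -/

/-- **Concatenation**: the word of length `M₁ + M₂` after `n` is the word of length `M₁` after
`n` followed by the word of length `M₂` after `n + M₁` (Tao 2016, §3: "`𝐗_{H₁+H₂}` is the
concatenation of `𝐗_{H₁}` and `𝐗_{H₁,H₁+H₂}`"). [cite: TaoFMP2016, §3 (derivation of (3.11))] -/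
theorem liouvilleWord_add (M₁ M₂ n : ℕ) :
    liouvilleWord (M₁ + M₂) n = Fin.append (liouvilleWord M₁ n) (liouvilleWord M₂ (n + M₁)) := by
  funext i
  induction i using Fin.addCases with
  | left j => rw [Fin.append_left]; simp [liouvilleWord]
  | right j =>
    rw [Fin.append_right, liouvilleWord_apply, liouvilleWord_apply]
    exact congrArg (fun t : ℕ => decide (ArithmeticFunction.liouville t = 1))
      (by rw [Fin.val_natAdd]; omega)

/-- **Exact subadditivity with the shifted block** (Tao 2016, (3.4) applied to the
concatenation): `𝐇(𝐗_{M₁+M₂}) ≤ 𝐇(𝐗_{M₁}) + 𝐇(𝐗_{M₁,M₁+M₂})`, the second block being the word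
of length `M₂` read after `n + M₁`, `n` uniform in `[0, X)`.
[cite: TaoFMP2016, §3 ((3.4) and the derivation of (3.11))] -/
theorem liouvilleBlockEntropy_add_le_shifted (X M₁ M₂ : ℕ) :
    liouvilleBlockEntropy X (M₁ + M₂) ≤ liouvilleBlockEntropy X M₁ +
      FiniteShannon.ent (Finset.range X) (fun _ => (1 : ℝ))
        (fun n => liouvilleWord M₂ (n + M₁)) := by
  rw [liouvilleBlockEntropy_eq_ent, liouvilleBlockEntropy_eq_ent]
  have h : liouvilleWord (M₁ + M₂) =
      (Fin.appendEquiv M₁ M₂) ∘ fun n => (liouvilleWord M₁ n, liouvilleWord M₂ (n + M₁)) := by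
    funext n
    exact liouvilleWord_add M₁ M₂ n
  rw [h, FiniteShannon.ent_comp_of_injOn (Fin.appendEquiv M₁ M₂).injective.injOn]
  exact FiniteShannon.ent_pair_le_add fun _ _ => zero_le_one

/-- Shifting the argument of a predicate by `a` changes its count on `[0, X)` by at most `a`.
[folklore] -/
theorem abs_card_filter_shift_sub_card_filter_le (p : ℕ → Prop) [DecidablePred p] (X a : ℕ) :
    |((((Finset.range X).filter fun n => p (n + a)).card : ℕ) : ℝ) -
        (((Finset.range X).filter p).card : ℕ)| ≤ a := by
  -- `A = #{m ∈ [a, X+a) : p m}`, `B = #{m ∈ [0, X) : p m}`, `C = #{m ∈ [a, X) : p m}`: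
  -- `C ≤ A ≤ C + a` and `C ≤ B ≤ C + a`.
  have hA : ((Finset.range X).filter fun n => p (n + a)).card =
      ((Finset.Ico a (X + a)).filter p).card := by
    refine Finset.card_bij (fun n _ => n + a) ?_ ?_ ?_
    · intro n hn
      simp only [Finset.mem_filter, Finset.mem_range, Finset.mem_Ico] at hn ⊢
      exact ⟨⟨by omega, by omega⟩, hn.2⟩
    · intro n₁ _ n₂ _ h
      omega
    · intro m hm
      simp only [Finset.mem_filter, Finset.mem_Ico] at hm
      refine ⟨m - a, ?_, by omega⟩
      simp only [Finset.mem_filter, Finset.mem_range]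
      exact ⟨by omega, by rw [Nat.sub_add_cancel hm.1.1]; exact hm.2⟩
  have h1 : ((Finset.Ico a (X + a)).filter p).card ≤ ((Finset.Ico a X).filter p).card + a := by
    calc ((Finset.Ico a (X + a)).filter p).card
        ≤ ((Finset.Ico a X).filter p ∪ Finset.Ico X (X + a)).card := by
          refine Finset.card_le_card fun m hm => ?_
          simp only [Finset.mem_filter, Finset.mem_Ico, Finset.mem_union] at hm ⊢
          rcases lt_or_ge m X with h | h
          · exact Or.inl ⟨⟨hm.1.1, h⟩, hm.2⟩
          · exact Or.inr ⟨h, hm.1.2⟩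
      _ ≤ ((Finset.Ico a X).filter p).card + (Finset.Ico X (X + a)).card :=
          Finset.card_union_le _ _
      _ = ((Finset.Ico a X).filter p).card + a := by simp
  have h2 : ((Finset.range X).filter p).card ≤ ((Finset.Ico a X).filter p).card + a := by
    calc ((Finset.range X).filter p).card
        ≤ ((Finset.Ico a X).filter p ∪ Finset.range a).card := by
          refine Finset.card_le_card fun m hm => ?_
          simp only [Finset.mem_filter, Finset.mem_Ico, Finset.mem_union, Finset.mem_range]
            at hm ⊢
          rcases lt_or_ge m a with h | h
          · exact Or.inr h
          · exact Or.inl ⟨⟨h, hm.1⟩, hm.2⟩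
      _ ≤ ((Finset.Ico a X).filter p).card + (Finset.range a).card :=
          Finset.card_union_le _ _
      _ = ((Finset.Ico a X).filter p).card + a := by simp
  have h3 : ((Finset.Ico a X).filter p).card ≤ ((Finset.Ico a (X + a)).filter p).card := by
    refine Finset.card_le_card (Finset.filter_subset_filter p fun m hm => ?_)
    simp only [Finset.mem_Ico] at hm ⊢
    omega
  have h4 : ((Finset.Ico a X).filter p).card ≤ ((Finset.range X).filter p).card := by
    refine Finset.card_le_card (Finset.filter_subset_filter p fun m hm => ?_)
    simp only [Finset.mem_Ico, Finset.mem_range] at hm ⊢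
    omega
  rw [hA, abs_sub_le_iff, sub_le_iff_le_add, sub_le_iff_le_add]
  constructor <;> norm_cast <;> omega

/-- **Approximate translation invariance of the empirical law**: the law of the word of length
`M` read after `n + a` (with `n` uniform in `[0, X)`) is within `a / X` of the law of the word
read after `n`, pointwise (the natural-scale counterpart of Tao 2016, Lemma 2.5 as used for
(3.11)). [cite: TaoFMP2016, §3 (display before (3.11))] -/
theorem abs_prob_shift_sub_liouvilleBlockFreq_le (X M a : ℕ) (w : Fin M → Bool) :
    |FiniteShannon.prob (Finset.range X) (fun _ => (1 : ℝ)) (fun n => liouvilleWord M (n + a)) w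
        - liouvilleBlockFreq X M w| ≤ a / X := by
  rw [liouvilleBlockFreq_eq_card_filter, FiniteShannon.prob_def, FiniteShannon.mass_def,
    FiniteShannon.mass_def]
  simp only [Finset.sum_const, nsmul_eq_mul, mul_one, Finset.card_range]
  rcases Nat.eq_zero_or_pos X with rfl | hX
  · simp
  · have hX' : (0 : ℝ) < X := by exact_mod_cast hX
    rw [← sub_div, abs_div, abs_of_pos hX', div_le_div_iff_of_pos_right hX']
    exact abs_card_filter_shift_sub_card_filter_le (fun n => liouvilleWord M n = w) X a

/-- The error term of the approximate subadditivity: `2^{M₂} (φ(M₁/X) + M₁/X)`. [folklore] -/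
def liouvilleBlockEntropySubaddError (M₁ M₂ X : ℕ) : ℝ :=
  2 ^ M₂ * (negMulLog ((M₁ : ℝ) / X) + (M₁ : ℝ) / X)

/-- Unfolding `liouvilleBlockEntropySubaddError`. [folklore] -/
theorem liouvilleBlockEntropySubaddError_def (M₁ M₂ X : ℕ) :
    liouvilleBlockEntropySubaddError M₁ M₂ X =
      2 ^ M₂ * (negMulLog ((M₁ : ℝ) / X) + (M₁ : ℝ) / X) :=
  rfl

/-- **Approximate translation invariance of the block entropy**: the entropy of the word of
length `M₂` read after `n + M₁` differs from `𝐇(𝐗_{M₂})` by at most `2^{M₂} (φ(M₁/X) + M₁/X)`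
when `M₁ ≤ X` (Tao 2016, the display before (3.11), `𝐇(𝐗_{H₁,H₁+H₂}) = 𝐇(𝐗_{H₂}) + o(1)`, at
natural scale with an explicit error, via continuity of entropy in the law).
[cite: TaoFMP2016, §3 (display before (3.11))] -/
theorem abs_ent_shift_sub_liouvilleBlockEntropy_le {X M₁ : ℕ} (hX : M₁ ≤ X) (M₂ : ℕ) :
    |FiniteShannon.ent (Finset.range X) (fun _ => (1 : ℝ)) (fun n => liouvilleWord M₂ (n + M₁))
        - liouvilleBlockEntropy X M₂| ≤ liouvilleBlockEntropySubaddError M₁ M₂ X := by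
  rw [liouvilleBlockEntropy_eq_ent, liouvilleBlockEntropySubaddError_def]
  have hδ1 : (M₁ : ℝ) / X ≤ 1 :=
    div_le_one_of_le₀ (by exact_mod_cast hX) (Nat.cast_nonneg X)
  have h := FiniteShannon.abs_ent_sub_ent_le (s := Finset.range X) (w := fun _ => (1 : ℝ))
    (X := fun n => liouvilleWord M₂ (n + M₁)) (s' := Finset.range X) (w' := fun _ => (1 : ℝ))
    (X' := liouvilleWord M₂) (fun _ _ => zero_le_one) (fun _ _ => zero_le_one)
    (t := Finset.univ) (Finset.subset_univ _) (Finset.subset_univ _) hδ1 (fun w _ => by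
      rw [← liouvilleBlockFreq_eq_prob]
      exact abs_prob_shift_sub_liouvilleBlockFreq_le X M₂ M₁ w)
  have hcard : ((Finset.univ : Finset (Fin M₂ → Bool)).card : ℝ) = 2 ^ M₂ := by
    rw [Finset.card_univ, Fintype.card_fun, Fintype.card_bool, Fintype.card_fin]
    push_cast
    rfl
  rwa [hcard] at h

/-- **Approximate subadditivity of the Liouville block entropy** (Tao 2016, (3.11), at natural
scale and with an explicit error): for `M₁ ≤ X`,
`𝐇_X(M₁ + M₂) ≤ 𝐇_X(M₁) + 𝐇_X(M₂) + 2^{M₂} (φ(M₁/X) + M₁/X)`.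
[cite: TaoFMP2016, §3 (3.11)] -/
theorem liouvilleBlockEntropy_add_le {X M₁ : ℕ} (hX : M₁ ≤ X) (M₂ : ℕ) :
    liouvilleBlockEntropy X (M₁ + M₂) ≤
      liouvilleBlockEntropy X M₁ + liouvilleBlockEntropy X M₂ +
        liouvilleBlockEntropySubaddError M₁ M₂ X := by
  have h1 := liouvilleBlockEntropy_add_le_shifted X M₁ M₂
  have h2 := (abs_sub_le_iff.1 (abs_ent_shift_sub_liouvilleBlockEntropy_le hX M₂)).1
  linarith

/-- The subadditivity error `2^{M₂} (φ(M₁/X) + M₁/X)` tends to `0` as `X → ∞` (for fixed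
`M₁, M₂`). [folklore] -/
theorem tendsto_liouvilleBlockEntropySubaddError (M₁ M₂ : ℕ) :
    Tendsto (fun X : ℕ => liouvilleBlockEntropySubaddError M₁ M₂ X) atTop (𝓝 0) := by
  have h0 : Tendsto (fun X : ℕ => (M₁ : ℝ) / X) atTop (𝓝 0) :=
    tendsto_const_div_atTop_nhds_zero_nat _
  have h1 : Tendsto (fun X : ℕ => negMulLog ((M₁ : ℝ) / X)) atTop (𝓝 0) := by
    have := (continuous_negMulLog.tendsto 0).comp h0
    simpa [Function.comp_def] using this
  have h2 := (h1.add h0).const_mul ((2 : ℝ) ^ M₂)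
  simpa [liouvilleBlockEntropySubaddError] using h2

/-- **Approximate subadditivity, `o(1)` form**: for fixed `M₁, M₂` there is an error `E(X) → 0`
with `𝐇_X(M₁ + M₂) ≤ 𝐇_X(M₁) + 𝐇_X(M₂) + E(X)` for EVERY `X` (for `X < M₁` one may take the
trivial bound `(M₁ + M₂) log 2`): Tao 2016, (3.11), for the empirical law at natural scale.
[cite: TaoFMP2016, §3 (3.11)] -/
theorem liouvilleBlockEntropy_add_le_add_add_littleO (M₁ M₂ : ℕ) :
    ∃ E : ℕ → ℝ, Tendsto E atTop (𝓝 0) ∧ ∀ X : ℕ,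
      liouvilleBlockEntropy X (M₁ + M₂) ≤
        liouvilleBlockEntropy X M₁ + liouvilleBlockEntropy X M₂ + E X := by
  refine ⟨fun X => if M₁ ≤ X then liouvilleBlockEntropySubaddError M₁ M₂ X
    else ((M₁ + M₂ : ℕ) : ℝ) * Real.log 2, ?_, fun X => ?_⟩
  · refine (tendsto_liouvilleBlockEntropySubaddError M₁ M₂).congr' ?_
    filter_upwards [eventually_ge_atTop M₁] with X hX
    rw [if_pos hX]
  · dsimp only
    by_cases hX : M₁ ≤ X
    · rw [if_pos hX]
      exact liouvilleBlockEntropy_add_le hX M₂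
    · rw [if_neg hX]
      have h1 := liouvilleBlockEntropy_le X (M₁ + M₂)
      have h2 := liouvilleBlockEntropy_nonneg X M₁
      have h3 := liouvilleBlockEntropy_nonneg X M₂
      linarith

end Literature.NumberTheory.Multiplicative

end
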